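import Summits.QuantumFields.YangMills.Theorems.UnitScaleTiltProp7SectET3GaugeProjectorT3
import Summits.QuantumFields.YangMills.Theorems.UnitScaleTiltProp7SectET3RealCoordSums
import Literature.MathematicalPhysics.QuantumFieldTheory.Balaban1983to89.B11Eq103H1ComplexReality
import HarnessLib

/-!
# Route `UnitScaleTilt` (α), node N06(d = 3), LAYER 0 — **REALITY OF THE HILBERT LETTERS OF BRICK L0a ∕ L0c**: the route's conjugation `X ↦ Xᴴ` (pointwise on the
# `M₂(ℂ)`-valued carriers, read on the weighted `L²` spaces through `toL2` ∕ `toL2S` ∕ `toL2B`) is an ANTI-UNITARY INVOLUTION for print's scalar products (3.11)∕(3.16), and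
# `D_{U₀}` (3.3), `D*_{U₀}` (3.8), `Δ^η_{U₀}` (3.23) COMMUTE WITH IT at every `SU(2)` background; `Q(U₀)`, `Q*(U₀)`, `Q(U₀)D_{U₀}` and the gauge projector `R_S(U₀)` (3.21)
# commute with it GIVEN the one displayed fact «`QTwS U₀` commutes with `X ↦ Xᴴ`» (the data rows of the EX knit v2.9ˢ reality assembly for `hH₁R` ∕ `h46tw`.(R-H) ∕ `hA₁R`)

Cell `ym-inputs` (D-0154 (2)), seat ym-inputs-p03 gen 2; ★w2-19200 g3's hand-over 10:18:47Z «the rows `hH₁R`∕`hA₁R`∕`h46tw`.(R-H) are yours to supply with the letters»;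
split with ★w4-20520 g4 (bus 2026-08-28T10:44–10:51Z): this file = the CONCRETE conjugation triple with its four properties, the data row `hD` (`D_{U₀}` real, PROVED) and
the data row `hQ` (`Q(U₀)` real, from the displayed `QTwS` row) that ★w4's generic assembly `…SectET3PropagatorsReality` (any involution kind; `D*`, `Δ^η`, `Q′`, `R_S`, `Δ′_a`, `G′`,
`Δ_π`, `Δ_a`, `G`, `(QGQ*)⁻¹`, `H`, `𝔓`, `𝔊`, `Hf`, `H46`) consumes; `D*`∕`Δ^η` are also given here in concrete form for direct readers.  Count-neutral helper
(`--supports stmt-QuantumFields-20520 --as helper`); registry untouched; THEOREMS ONLY (0 `def`, 0 `sorry`); nothing of print's estimates asserted.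

THE CONJUGATION, SPELLED (no definition): on the fine vector fields `σ f := toL2 (star (toL2⁻¹ f))`, on the gauge parameters `σ g := toL2S (star (toL2S⁻¹ g))`, on the block
fields `σ y := toL2B (star (toL2B⁻¹ y))` — `star` = the pointwise conjugate transpose of `PBond … → M₂(ℂ)` ∕ `Site … → M₂(ℂ)`.  A `ℂ`-linear `T` «maps Hermitian-valued fields to
Hermitian-valued fields» iff `T ∘ σ = σ ∘ T` (`M₂(ℂ) = Herm ⊕ i·Herm`).

WHAT IS PROVED.
* §1 the three conjugations are additive, involutive, `ℝ`-homogeneous and ANTI-UNITARY: `⟪σ f, σ g⟫ = ⟪g, f⟫` (✓`inner_toL2` ∕ `inner_toL2B` ∕ ✓`Prop7SectET3RealCoordSums.inner_toL2S` + `tr(XYᴴ) = tr(Yᴴ X)`) — exactly the hypotheses of lit ✓`B11Eq103H1ComplexReality.adjoint_map_comm_of_anti` ∕ `projR_map_comm_of_anti`.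
* §2 ★`DL2_star_comm` — `D_{U₀}(σλ) = σ(D_{U₀}λ)` from the stencil ✓`DL2_apply` and `U⁻¹ = Uᴴ` on `SU(2)` (`(UλU⁻¹)ᴴ = UλᴴU⁻¹`, `η` real); ★`DstarL2_star_comm` — by
  ✓`adjoint_DL2` (`D* = D†`) and the generic adjoint lemma, NO second stencil computation; `covLapSite_star_comm` (`Δ^η = D*D`).
* §3 under the ONE displayed hypothesis `hQ : ∀ A, QTwS U₀ (star A) = star (QTwS U₀ A)` (★w4-20520 g4's ✓`Prop7QTwSReality` gives it on `𝔰𝔲(2)`-valued `A` at `RegPr` backgrounds;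
  the SCALAR sector `A = c·1` is the non-generic remainder — memo `pub/ym-inputs/REALITY-ROWS-LOCATE-p03g2.md` §3; the bridge from the two sector facts to `hQ` is the sequel
  `…QTwSRealitySectors`): ★`QL2_star_comm_of` (= the data row `hQ` of ★w4-20520 g4's `…SectET3PropagatorsReality` at this triple), ★`adjoint_QL2_star_comm_of` (`Q* = Q†` real),
  `QadjPi_star_comm_of` (the route-carrier form).  `Q′ = QD`, `R_S`, `Δ′_a`, `G′`, `Δ_π`, `G`, `H`, `𝔊` downstream are ★w4-20520 g4's `…SectET3PropagatorsReality` (generic in the involution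
  kind; its data rows `hD`∕`hQ` are §2∕§3 here).
* §4 the TRACE sector for the derivative letters: `trace_DL2_apply_eq_zero` (traceless `λ` ↦ traceless `D_{U₀}λ`) and `DL2_apply_scalar` (scalar `λ = c·1` ↦ scalar `D_{U₀}λ`),
  pointwise on the route carriers (`tr(UXU⁻¹) = tr X`, `U(c·1)U⁻¹ = c·1`).
HONEST SCOPE: `SU(2)` ∕ Frobenius algebra and bookkeeping through brick L0a's `rfl`-level readers; the `QTwS` row is DISPLAYED, not proved; nothing of [B9] ∕ [B11]'s estimates;
N06(d = 3) NOT discharged; no claim on EX, the crux, d = 4 or the gap; YM₃ on T³ = rung R3 (RECORD), not Clay.  L-FLOOR: none (every odd `L > 1`, every member).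

References: T. Bałaban, CMP **99** (1985) 389–434 [Balaban1985BackgroundPropagators] ((3.3) p.391, (3.8) p.392, (3.11) p.392, (3.16) p.393, (3.21)–(3.23) p.394, p.393
«complexified Lie algebra»); CMP **102** (1985) 277–309 [Balaban1985Variational] ((51) p.286 «for A′ with values in 𝔤 the configuration D(A′) has values in 𝔤 also»).
-/

set_option autoImplicit false

noncomputable section

open scoped InnerProductSpace ComplexConjugate Matrix.Norms.L2Operator BigOperators

namespace Summit.QuantumFields.YangMills.Theorems.Prop7SectET3HilbertLettersReality

open Literature.MathematicalPhysics.QuantumFieldTheory.Balaban1983to89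
open Literature.MathematicalPhysics.QuantumFieldTheory.Balaban1983to89.T3ContinuumYM3Torus
open T3SectALandauChart (eta)
open B4Sect5Torus (TSite)
open B9SectCLatticeCarrier (Bond)
open B9Eq311L2Pairing (WL2)
open B11Eq103H1Complex (SiteL2K BondL2K projR)
open B11Eq103H1ComplexReality (adjoint_map_comm_of_anti projR_map_comm_of_anti)
open Summit.QuantumFields.YangMills.Theorems.Prop7SectET3Transport (periodsT3 siteEquiv bondEquiv bgOfCfg val_bgOfCfg isUnitaryBg_bgOfCfg)
open Summit.QuantumFields.YangMills.Theorems.Prop7SectET3HilbertLetters (W₂ frobEquiv adBg adBgInv toL2 toL2S toL2B QL2 QadjPi DL2 DstarL2 covLapSite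
  toL2_apply toL2_symm_apply toL2S_apply toL2S_symm_apply toL2B_apply toL2B_symm_apply inner_toL2 inner_toL2B inner_frobEquiv_symm adjoint_DL2 DL2_apply QL2_toL2 toL2_QadjPi)
open Summit.QuantumFields.YangMills.Theorems.Prop7SectET3GaugeProjector (DstarPi DstarPi_apply)
open Summit.QuantumFields.YangMills.Theorems.Prop7SectET3RealCoordSums (inner_toL2S)
open Summit.QuantumFields.YangMills.Theorems.Prop7SymAvgTwSym (QTwS)

variable {F : T3Family} {n K : ℕ} {h : n ≤ K} {c₀ cB : ℝ}

/-! ## §1 The conjugations on the three carriers: additive, involutive, real-homogeneous, anti-unitary -/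

section Conjugations

/-- `σ` on the fine vector fields is an involution. [cite: Balaban1985BackgroundPropagators, (3.11) p.392] -/
theorem toL2_star_star (f : BondL2K ℂ 3 (periodsT3 F K) c₀ W₂) :
    toL2 F K c₀ (star ((toL2 F K c₀).symm (toL2 F K c₀ (star ((toL2 F K c₀).symm f))))) = f := by
  rw [LinearEquiv.symm_apply_apply, star_star, LinearEquiv.apply_symm_apply]

/-- `σ` on the fine vector fields is additive. [cite: Balaban1985BackgroundPropagators, (3.11) p.392] -/
theorem toL2_star_add (f g : BondL2K ℂ 3 (periodsT3 F K) c₀ W₂) :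
    toL2 F K c₀ (star ((toL2 F K c₀).symm (f + g))) = toL2 F K c₀ (star ((toL2 F K c₀).symm f)) + toL2 F K c₀ (star ((toL2 F K c₀).symm g)) := by
  rw [map_add, star_add, map_add]

/-- `σ` on the fine vector fields is `ℝ`-homogeneous: `σ(r•f) = r•σf` for real `r`. [cite: Balaban1985BackgroundPropagators, (3.11) p.392] -/
theorem toL2_star_smul_real (r : ℝ) (f : BondL2K ℂ 3 (periodsT3 F K) c₀ W₂) :
    toL2 F K c₀ (star ((toL2 F K c₀).symm (((r : ℂ)) • f))) = ((r : ℂ)) • toL2 F K c₀ (star ((toL2 F K c₀).symm f)) := by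
  rw [map_smul, star_smul, Complex.star_def, Complex.conj_ofReal, map_smul]

/-- **`σ` ON THE FINE VECTOR FIELDS IS ANTI-UNITARY FOR PRINT'S SCALAR PRODUCT (3.11)**: `⟪σf, σg⟫ = ⟪g, f⟫` (`tr((Xᴴ)ᴴ Yᴴ) = tr(X Yᴴ) = tr(Yᴴ X)`).
[cite: Balaban1985BackgroundPropagators, (3.11) p.392] -/
theorem inner_toL2_star [Fact (0 < c₀)] (f g : BondL2K ℂ 3 (periodsT3 F K) c₀ W₂) :
    ⟪toL2 F K c₀ (star ((toL2 F K c₀).symm f)), toL2 F K c₀ (star ((toL2 F K c₀).symm g))⟫_ℂ = ⟪g, f⟫_ℂ := by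
  conv_rhs => rw [← (toL2 F K c₀).apply_symm_apply g, ← (toL2 F K c₀).apply_symm_apply f]
  rw [inner_toL2, inner_toL2]
  refine congrArg _ (Finset.sum_congr rfl fun b _ => ?_)
  rw [Pi.star_apply, Pi.star_apply, Matrix.star_eq_conjTranspose, Matrix.star_eq_conjTranspose, Matrix.conjTranspose_conjTranspose, Matrix.trace_mul_comm]

/-- `σ` on the gauge parameters is an involution. [cite: Balaban1985BackgroundPropagators, p.393] -/
theorem toL2S_star_star (g : SiteL2K ℂ 3 (periodsT3 F K) c₀ W₂) :
    toL2S F K c₀ (star ((toL2S F K c₀).symm (toL2S F K c₀ (star ((toL2S F K c₀).symm g))))) = g := by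
  rw [LinearEquiv.symm_apply_apply, star_star, LinearEquiv.apply_symm_apply]

/-- `σ` on the gauge parameters is additive. [cite: Balaban1985BackgroundPropagators, p.393] -/
theorem toL2S_star_add (f g : SiteL2K ℂ 3 (periodsT3 F K) c₀ W₂) :
    toL2S F K c₀ (star ((toL2S F K c₀).symm (f + g))) = toL2S F K c₀ (star ((toL2S F K c₀).symm f)) + toL2S F K c₀ (star ((toL2S F K c₀).symm g)) := by
  rw [map_add, star_add, map_add]

/-- `σ` on the gauge parameters is `ℝ`-homogeneous. [cite: Balaban1985BackgroundPropagators, p.393] -/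
theorem toL2S_star_smul_real (r : ℝ) (g : SiteL2K ℂ 3 (periodsT3 F K) c₀ W₂) :
    toL2S F K c₀ (star ((toL2S F K c₀).symm (((r : ℂ)) • g))) = ((r : ℂ)) • toL2S F K c₀ (star ((toL2S F K c₀).symm g)) := by
  rw [map_smul, star_smul, Complex.star_def, Complex.conj_ofReal, map_smul]

/-- **`σ` ON THE GAUGE PARAMETERS IS ANTI-UNITARY**: `⟪σg, σg′⟫ = ⟪g′, g⟫`. [cite: Balaban1985BackgroundPropagators, (3.11) p.392, p.393] -/
theorem inner_toL2S_star [Fact (0 < c₀)] (f g : SiteL2K ℂ 3 (periodsT3 F K) c₀ W₂) :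
    ⟪toL2S F K c₀ (star ((toL2S F K c₀).symm f)), toL2S F K c₀ (star ((toL2S F K c₀).symm g))⟫_ℂ = ⟪g, f⟫_ℂ := by
  conv_rhs => rw [← (toL2S F K c₀).apply_symm_apply g, ← (toL2S F K c₀).apply_symm_apply f]
  rw [inner_toL2S, inner_toL2S]
  refine congrArg _ (Finset.sum_congr rfl fun x _ => ?_)
  rw [Pi.star_apply, Pi.star_apply, Matrix.star_eq_conjTranspose, Matrix.star_eq_conjTranspose, Matrix.conjTranspose_conjTranspose, Matrix.trace_mul_comm]

/-- `σ` on the block fields is an involution. [cite: Balaban1985BackgroundPropagators, (3.16) p.393] -/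
theorem toL2B_star_star (y : WL2 ℂ (fun _ : PBond (F.P n) 0 => cB) W₂) :
    toL2B F n cB (star ((toL2B F n cB).symm (toL2B F n cB (star ((toL2B F n cB).symm y))))) = y := by
  rw [LinearEquiv.symm_apply_apply, star_star, LinearEquiv.apply_symm_apply]

/-- `σ` on the block fields is additive. [cite: Balaban1985BackgroundPropagators, (3.16) p.393] -/
theorem toL2B_star_add (y y' : WL2 ℂ (fun _ : PBond (F.P n) 0 => cB) W₂) :
    toL2B F n cB (star ((toL2B F n cB).symm (y + y'))) = toL2B F n cB (star ((toL2B F n cB).symm y)) + toL2B F n cB (star ((toL2B F n cB).symm y')) := by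
  rw [map_add, star_add, map_add]

/-- `σ` on the block fields is `ℝ`-homogeneous. [cite: Balaban1985BackgroundPropagators, (3.16) p.393] -/
theorem toL2B_star_smul_real (r : ℝ) (y : WL2 ℂ (fun _ : PBond (F.P n) 0 => cB) W₂) :
    toL2B F n cB (star ((toL2B F n cB).symm (((r : ℂ)) • y))) = ((r : ℂ)) • toL2B F n cB (star ((toL2B F n cB).symm y)) := by
  rw [map_smul, star_smul, Complex.star_def, Complex.conj_ofReal, map_smul]

/-- **`σ` ON THE BLOCK FIELDS IS ANTI-UNITARY FOR THE BLOCK PAIRING (3.16).** [cite: Balaban1985BackgroundPropagators, (3.16) p.393] -/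
theorem inner_toL2B_star [Fact (0 < cB)] (y y' : WL2 ℂ (fun _ : PBond (F.P n) 0 => cB) W₂) :
    ⟪toL2B F n cB (star ((toL2B F n cB).symm y)), toL2B F n cB (star ((toL2B F n cB).symm y'))⟫_ℂ = ⟪y', y⟫_ℂ := by
  conv_rhs => rw [← (toL2B F n cB).apply_symm_apply y', ← (toL2B F n cB).apply_symm_apply y]
  rw [inner_toL2B, inner_toL2B]
  refine congrArg _ (Finset.sum_congr rfl fun c _ => ?_)
  rw [Pi.star_apply, Pi.star_apply, Matrix.star_eq_conjTranspose, Matrix.star_eq_conjTranspose, Matrix.conjTranspose_conjTranspose, Matrix.trace_mul_comm]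

end Conjugations

/-! ## §2 `D_{U₀}`, `D*_{U₀}`, `Δ^η_{U₀}` commute with the conjugation at every `SU(2)` background -/

section Derivatives

variable [Fact (0 < c₀)]

/-- ★ **`D_{U₀}(λᴴ) = (D_{U₀}λ)ᴴ`** — the covariant derivative (3.3) is REAL: `(η⁻¹(U λ(b₊) U⁻¹ − λ(b₋)))ᴴ = η⁻¹(U λ(b₊)ᴴ U⁻¹ − λ(b₋)ᴴ)` since `U⁻¹ = Uᴴ` on `SU(2)` and `η ∈ ℝ`.
[cite: Balaban1985BackgroundPropagators, (3.3) p.391, p.393; Balaban1985Variational, (51) p.286] -/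
theorem DL2_star_comm (U₀ : GaugeField (F.P K) 0 (Matrix.specialUnitaryGroup (Fin 2) ℂ)) (g : SiteL2K ℂ 3 (periodsT3 F K) c₀ W₂) :
    DL2 F n K c₀ U₀ (toL2S F K c₀ (star ((toL2S F K c₀).symm g))) = toL2 F K c₀ (star ((toL2 F K c₀).symm (DL2 F n K c₀ U₀ g))) := by
  -- read `g` as a route site function `l`
  obtain ⟨l, rfl⟩ : ∃ l, g = toL2S F K c₀ l := ⟨(toL2S F K c₀).symm g, ((toL2S F K c₀).apply_symm_apply g).symm⟩
  rw [LinearEquiv.symm_apply_apply]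
  apply (toL2 F K c₀).symm.injective
  rw [LinearEquiv.symm_apply_apply]
  funext b
  -- the unitarity of the background: `(U₀ b)⁻¹ = (U₀ b)ᴴ`
  have hinv : ((((bgOfCfg F K U₀ (bondEquiv F K b))⁻¹ : (Matrix (Fin 2) (Fin 2) ℂ)ˣ) : Matrix (Fin 2) (Fin 2) ℂ)) =
      star (((U₀ b : Matrix.specialUnitaryGroup (Fin 2) ℂ) : Matrix (Fin 2) (Fin 2) ℂ)) := by
    rw [isUnitaryBg_bgOfCfg, val_bgOfCfg, Equiv.symm_apply_apply]
  have h1 := DL2_apply (n := n) (c₀ := c₀) U₀ (star l) b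
  have h2 := DL2_apply (n := n) (c₀ := c₀) U₀ l b
  rw [h1]
  refine Eq.trans ?_ (congrArg star h2).symm
  rw [hinv, star_smul, star_sub, star_mul, star_mul, star_star, ← mul_assoc, ← Complex.ofReal_inv, Complex.star_def, Complex.conj_ofReal]
  rfl

/-- ★ **`D*_{U₀}` IS REAL** — because `D* = D†` (✓`adjoint_DL2`) and adjoints of real operators are real for anti-unitary conjugations (lit ✓`adjoint_map_comm_of_anti`); no second
stencil computation. [cite: Balaban1985BackgroundPropagators, (3.8) p.392, p.393; Balaban1985Variational, (51) p.286] -/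
theorem DstarL2_star_comm (U₀ : GaugeField (F.P K) 0 (Matrix.specialUnitaryGroup (Fin 2) ℂ)) (f : BondL2K ℂ 3 (periodsT3 F K) c₀ W₂) :
    DstarL2 F n K c₀ U₀ (toL2 F K c₀ (star ((toL2 F K c₀).symm f))) = toL2S F K c₀ (star ((toL2S F K c₀).symm (DstarL2 F n K c₀ U₀ f))) := by
  rw [← adjoint_DL2]
  exact adjoint_map_comm_of_anti (DL2 F n K c₀ U₀) (fun g => toL2S F K c₀ (star ((toL2S F K c₀).symm g))) (fun f => toL2 F K c₀ (star ((toL2 F K c₀).symm f)))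
    inner_toL2S_star toL2S_star_star inner_toL2_star toL2_star_star (DL2_star_comm U₀) f

/-- **`Δ^η_{U₀} = D*_{U₀}D_{U₀}` IS REAL.** [cite: Balaban1985BackgroundPropagators, (3.23) p.394, p.393] -/
theorem covLapSite_star_comm (U₀ : GaugeField (F.P K) 0 (Matrix.specialUnitaryGroup (Fin 2) ℂ)) (g : SiteL2K ℂ 3 (periodsT3 F K) c₀ W₂) :
    covLapSite F n K c₀ U₀ (toL2S F K c₀ (star ((toL2S F K c₀).symm g))) = toL2S F K c₀ (star ((toL2S F K c₀).symm (covLapSite F n K c₀ U₀ g))) := by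
  rw [covLapSite, LinearMap.comp_apply, LinearMap.comp_apply, DL2_star_comm, DstarL2_star_comm]

/-- **`D*_{U₀}` READ BACK ON THE ROUTE CARRIERS IS REAL**: `DstarPi U₀ (Xᴴ) = (DstarPi U₀ X)ᴴ`. [cite: Balaban1985BackgroundPropagators, (3.8) p.392, p.393] -/
theorem DstarPi_star_comm (U₀ : GaugeField (F.P K) 0 (Matrix.specialUnitaryGroup (Fin 2) ℂ)) (A : PBond (F.P K) 0 → Matrix (Fin 2) (Fin 2) ℂ) :
    DstarPi F n K c₀ U₀ (star A) = star (DstarPi F n K c₀ U₀ A) := by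
  rw [DstarPi_apply, DstarPi_apply]
  have h := DstarL2_star_comm (n := n) U₀ (toL2 F K c₀ A)
  rw [LinearEquiv.symm_apply_apply] at h
  rw [h, LinearEquiv.symm_apply_apply]

end Derivatives

/-! ## §3 `Q(U₀)`, `Q*(U₀)`, `Q(U₀)D_{U₀}`, `R_S(U₀)` — real GIVEN the displayed reality of `QTwS U₀` -/

section Averaging

variable [Fact (0 < c₀)] [Fact (0 < cB)]

omit [Fact (0 < c₀)] [Fact (0 < cB)] in
/-- ★ **`Q(U₀)` ON `L²` IS REAL IF `QTwS U₀` IS** (the displayed row `hQ`). [cite: Balaban1985BackgroundPropagators, (3.14) p.393; Balaban1985Variational, (51) p.286] -/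
theorem QL2_star_comm_of (U₀ : GaugeField (F.P K) 0 (Matrix.specialUnitaryGroup (Fin 2) ℂ))
    (hQ : ∀ A : PBond (F.P K) 0 → Matrix (Fin 2) (Fin 2) ℂ, QTwS F n K h U₀ (star A) = star (QTwS F n K h U₀ A)) (f : BondL2K ℂ 3 (periodsT3 F K) c₀ W₂) :
    QL2 F n K h c₀ cB U₀ (toL2 F K c₀ (star ((toL2 F K c₀).symm f))) = toL2B F n cB (star ((toL2B F n cB).symm (QL2 F n K h c₀ cB U₀ f))) := by
  obtain ⟨A, rfl⟩ : ∃ A, f = toL2 F K c₀ A := ⟨(toL2 F K c₀).symm f, ((toL2 F K c₀).apply_symm_apply f).symm⟩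
  rw [LinearEquiv.symm_apply_apply, QL2_toL2, QL2_toL2, LinearEquiv.symm_apply_apply, hQ]

/-- ★ **`Q*(U₀) = Q(U₀)†` IS REAL IF `QTwS U₀` IS** — lit ✓`adjoint_map_comm_of_anti` with the anti-unitary conjugations of §1.
[cite: Balaban1985BackgroundPropagators, p.391, (3.126) p.420; Balaban1985Variational, (51) p.286] -/
theorem adjoint_QL2_star_comm_of (U₀ : GaugeField (F.P K) 0 (Matrix.specialUnitaryGroup (Fin 2) ℂ))
    (hQ : ∀ A : PBond (F.P K) 0 → Matrix (Fin 2) (Fin 2) ℂ, QTwS F n K h U₀ (star A) = star (QTwS F n K h U₀ A)) (y : WL2 ℂ (fun _ : PBond (F.P n) 0 => cB) W₂) :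
    LinearMap.adjoint (QL2 F n K h c₀ cB U₀) (toL2B F n cB (star ((toL2B F n cB).symm y))) =
      toL2 F K c₀ (star ((toL2 F K c₀).symm (LinearMap.adjoint (QL2 F n K h c₀ cB U₀) y))) :=
  adjoint_map_comm_of_anti (QL2 F n K h c₀ cB U₀) (fun f => toL2 F K c₀ (star ((toL2 F K c₀).symm f))) (fun y => toL2B F n cB (star ((toL2B F n cB).symm y)))
    inner_toL2_star toL2_star_star inner_toL2B_star toL2B_star_star (QL2_star_comm_of U₀ hQ) y

/-- **`Q*(U₀)` READ BACK ON THE ROUTE CARRIERS IS REAL IF `QTwS U₀` IS**: `QadjPi U₀ (Yᴴ) = (QadjPi U₀ Y)ᴴ`. [cite: Balaban1985BackgroundPropagators, p.391, (3.126) p.420] -/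
theorem QadjPi_star_comm_of (U₀ : GaugeField (F.P K) 0 (Matrix.specialUnitaryGroup (Fin 2) ℂ))
    (hQ : ∀ A : PBond (F.P K) 0 → Matrix (Fin 2) (Fin 2) ℂ, QTwS F n K h U₀ (star A) = star (QTwS F n K h U₀ A)) (Y : PBond (F.P n) 0 → Matrix (Fin 2) (Fin 2) ℂ) :
    QadjPi F n K h c₀ cB U₀ (star Y) = star (QadjPi F n K h c₀ cB U₀ Y) := by
  apply (toL2 F K c₀).injective
  have h' := adjoint_QL2_star_comm_of (c₀ := c₀) U₀ hQ (toL2B F n cB Y)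
  rw [LinearEquiv.symm_apply_apply, ← toL2_QadjPi, ← toL2_QadjPi, LinearEquiv.symm_apply_apply] at h'
  exact h'

end Averaging

/-! ## §4 The trace sector of the derivative letters (pointwise, on the route carriers) -/

section Trace

variable [Fact (0 < c₀)]

/-- **`D_{U₀}` MAPS TRACELESS GAUGE PARAMETERS TO TRACELESS VECTOR FIELDS**: `tr(U λ U⁻¹ − λ′) = tr λ − tr λ′`. [cite: Balaban1985BackgroundPropagators, (3.3) p.391, p.393] -/
theorem trace_DL2_apply_eq_zero (U₀ : GaugeField (F.P K) 0 (Matrix.specialUnitaryGroup (Fin 2) ℂ)) (l : Site (F.P K) 0 → Matrix (Fin 2) (Fin 2) ℂ)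
    (hl : ∀ x, Matrix.trace (l x) = 0) (b : PBond (F.P K) 0) :
    Matrix.trace ((toL2 F K c₀).symm (DL2 F n K c₀ U₀ (toL2S F K c₀ l)) b) = 0 := by
  have hinv : ((((bgOfCfg F K U₀ (bondEquiv F K b))⁻¹ : (Matrix (Fin 2) (Fin 2) ℂ)ˣ) : Matrix (Fin 2) (Fin 2) ℂ)) =
      star (((U₀ b : Matrix.specialUnitaryGroup (Fin 2) ℂ) : Matrix (Fin 2) (Fin 2) ℂ)) := by
    rw [isUnitaryBg_bgOfCfg, val_bgOfCfg, Equiv.symm_apply_apply]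
  have hU : star (((U₀ b : Matrix.specialUnitaryGroup (Fin 2) ℂ) : Matrix (Fin 2) (Fin 2) ℂ)) * ((U₀ b : Matrix.specialUnitaryGroup (Fin 2) ℂ) : Matrix (Fin 2) (Fin 2) ℂ) = 1 :=
    Matrix.mem_unitaryGroup_iff'.1 (Matrix.mem_specialUnitaryGroup_iff.1 (U₀ b).2).1
  rw [DL2_apply, Matrix.trace_smul, Matrix.trace_sub, Matrix.trace_mul_cycle, hinv, hU, one_mul, hl, hl, sub_zero, smul_zero]

/-- **`D_{U₀}` MAPS SCALAR GAUGE PARAMETERS `λ = c·1` TO SCALAR VECTOR FIELDS**: `U(c1)U⁻¹ − c′1 = (c − c′)·1`. [cite: Balaban1985BackgroundPropagators, (3.3) p.391, p.393] -/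
theorem DL2_apply_scalar (U₀ : GaugeField (F.P K) 0 (Matrix.specialUnitaryGroup (Fin 2) ℂ)) (c : Site (F.P K) 0 → ℂ) (b : PBond (F.P K) 0) :
    (toL2 F K c₀).symm (DL2 F n K c₀ U₀ (toL2S F K c₀ (fun x => c x • (1 : Matrix (Fin 2) (Fin 2) ℂ)))) b =
      ((((eta F n K : ℝ) : ℂ)⁻¹) * (c b.tgt - c b.src)) • (1 : Matrix (Fin 2) (Fin 2) ℂ) := by
  have hinv : ((((bgOfCfg F K U₀ (bondEquiv F K b))⁻¹ : (Matrix (Fin 2) (Fin 2) ℂ)ˣ) : Matrix (Fin 2) (Fin 2) ℂ)) =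
      star (((U₀ b : Matrix.specialUnitaryGroup (Fin 2) ℂ) : Matrix (Fin 2) (Fin 2) ℂ)) := by
    rw [isUnitaryBg_bgOfCfg, val_bgOfCfg, Equiv.symm_apply_apply]
  have hU : ((U₀ b : Matrix.specialUnitaryGroup (Fin 2) ℂ) : Matrix (Fin 2) (Fin 2) ℂ) * star (((U₀ b : Matrix.specialUnitaryGroup (Fin 2) ℂ) : Matrix (Fin 2) (Fin 2) ℂ)) = 1 :=
    Matrix.mem_unitaryGroup_iff.1 (Matrix.mem_specialUnitaryGroup_iff.1 (U₀ b).2).1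
  rw [DL2_apply, Matrix.mul_smul, Matrix.mul_one, Matrix.smul_mul, hinv, hU, ← sub_smul, smul_smul]

end Trace

end Summit.QuantumFields.YangMills.Theorems.Prop7SectET3HilbertLettersReality

end
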